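import Summits.CriticalPhenomena.PercolationContinuityZ3.Theorems.PercNearOneGluingNoHeavyLowerTailIncStarTwoCutNearRows
import HarnessLib

/-!
# Two-cuts with the root and one target on the root side (MODE B), VII: the four Harris rows of the near lemma

Support file for the Sahi programme (`--supports stmt-CriticalPhenomena-4575`, prover prim-sahi-p2 gen 26).  No definitions, no named
facts, no sorries; standard axioms.  Memo `run/shared/lean/prim/prim-sahi/FROM-prim-sahi-p2-gen26-NEAR-LEMMA.md` §3, §9.

`IncStarTwoCut.near_harris_row` (part VI) proves the Harris row of the near lemma (N⁺) of THEOREM B⁺ for every increasing event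
`J ⊆ X̂ ∪ Ŷ` satisfying two off-cluster inequalities.  Here the four rows actually used by the A-part real core
(`IncStarTwoCut.twoCut_Apart_nonneg`: `J = X̂ = {s↔x}`, `Ŷ = {s↔y}`, `Û = X̂ ∪ Ŷ`, `Ŵ = X̂ ∩ Ŷ`) are obtained unconditionally (given
`μ(D_x), μ(D_y), μ(D₀) > 0`): for these `J` the off-cluster inequalities are either trivial (`J ∩ D_x = ∅`) or the loner-attachment
inequality `near_theta_le_tau` of part IV.
-/

noncomputable section

namespace Summit.CriticalPhenomena.PercolationContinuityZ3.Theorems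

namespace IncStarTwoCut

open MeasureTheory Set Literature.Probability.Percolation Literature.Probability.LatticeModels
open scoped Classical

variable {V : Type} [Fintype V]

section Sets
omit [Fintype V]
variable (s x y a : V)

/-- `E_x ∩ X̂ = ∅` (on `E_x`, `x ↮ s`). [folklore] -/
theorem Ex_inter_X : ((openConn x s)ᶜ ∩ (openConn x y)ᶜ ∩ openConn x a ∩ openConn s x : Set (BondConfig V)) = ∅ := by
  ext ω; simp only [mem_inter_iff, mem_compl_iff, openConn, mem_setOf_eq, mem_empty_iff_false, iff_false]
  rintro ⟨⟨⟨hxs, -⟩, -⟩, hsx⟩; exact hxs hsx.symm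

/-- `X̂ ∩ D_x = ∅`. [folklore] -/
theorem X_inter_Dx : (openConn s x ∩ ((openConn x s)ᶜ ∩ (openConn x y)ᶜ) : Set (BondConfig V)) = ∅ := by
  ext ω; simp only [mem_inter_iff, mem_compl_iff, openConn, mem_setOf_eq, mem_empty_iff_false, iff_false]
  rintro ⟨hsx, hxs, -⟩; exact hxs hsx.symm

/-- `E_x ∩ Ŷ = D_x ∩ ({x↔a} ∩ {s↔y})` (reassociation). [folklore] -/
theorem Ex_inter_Y : ((openConn x s)ᶜ ∩ (openConn x y)ᶜ ∩ openConn x a ∩ openConn s y : Set (BondConfig V))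
    = (openConn x s)ᶜ ∩ (openConn x y)ᶜ ∩ (openConn x a ∩ openConn s y) := by
  rw [inter_assoc]

/-- `Ŷ ∩ D_x = D_x ∩ Ŷ`. [folklore] -/
theorem Y_inter_Dx : (openConn s y ∩ ((openConn x s)ᶜ ∩ (openConn x y)ᶜ) : Set (BondConfig V))
    = (openConn x s)ᶜ ∩ (openConn x y)ᶜ ∩ openConn s y := by
  rw [inter_comm]

/-- `E_x ∩ Û = E_x ∩ Ŷ`. [folklore] -/
theorem Ex_inter_U : ((openConn x s)ᶜ ∩ (openConn x y)ᶜ ∩ openConn x a ∩ (openConn s x ∪ openConn s y) : Set (BondConfig V))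
    = (openConn x s)ᶜ ∩ (openConn x y)ᶜ ∩ (openConn x a ∩ openConn s y) := by
  ext ω; simp only [mem_inter_iff, mem_compl_iff, mem_union, openConn, mem_setOf_eq]
  constructor
  · rintro ⟨⟨⟨hxs, hxy⟩, hxa⟩, (hsx | hsy)⟩
    · exact absurd hsx.symm hxs
    · exact ⟨⟨hxs, hxy⟩, hxa, hsy⟩
  · rintro ⟨⟨hxs, hxy⟩, hxa, hsy⟩; exact ⟨⟨⟨hxs, hxy⟩, hxa⟩, Or.inr hsy⟩

/-- `Û ∩ D_x = D_x ∩ Ŷ`. [folklore] -/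
theorem U_inter_Dx : ((openConn s x ∪ openConn s y) ∩ ((openConn x s)ᶜ ∩ (openConn x y)ᶜ) : Set (BondConfig V))
    = (openConn x s)ᶜ ∩ (openConn x y)ᶜ ∩ openConn s y := by
  ext ω; simp only [mem_inter_iff, mem_compl_iff, mem_union, openConn, mem_setOf_eq]
  constructor
  · rintro ⟨(hsx | hsy), hxs, hxy⟩
    · exact absurd hsx.symm hxs
    · exact ⟨⟨hxs, hxy⟩, hsy⟩
  · rintro ⟨⟨hxs, hxy⟩, hsy⟩; exact ⟨Or.inr hsy, hxs, hxy⟩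

/-- `E_x ∩ Ŵ = ∅`. [folklore] -/
theorem Ex_inter_W : ((openConn x s)ᶜ ∩ (openConn x y)ᶜ ∩ openConn x a ∩ (openConn s x ∩ openConn s y) : Set (BondConfig V)) = ∅ := by
  ext ω; simp only [mem_inter_iff, mem_compl_iff, openConn, mem_setOf_eq, mem_empty_iff_false, iff_false]
  rintro ⟨⟨⟨hxs, -⟩, -⟩, hsx, -⟩; exact hxs hsx.symm

/-- `Ŵ ∩ D_x = ∅`. [folklore] -/
theorem W_inter_Dx : ((openConn s x ∩ openConn s y) ∩ ((openConn x s)ᶜ ∩ (openConn x y)ᶜ) : Set (BondConfig V)) = ∅ := by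
  ext ω; simp only [mem_inter_iff, mem_compl_iff, openConn, mem_setOf_eq, mem_empty_iff_false, iff_false]
  rintro ⟨⟨hsx, -⟩, hxs, -⟩; exact hxs hsx.symm

end Sets

/-- **The four Harris rows (N4)–(N7) of the near lemma.**  For distinct `s, x, y` with `μ(D_x), μ(D_y), μ(D₀) > 0` and
`J ∈ {X̂, Ŷ, X̂ ∪ Ŷ, X̂ ∩ Ŷ}`:
`μ(E_x)μ(D_y)[μ(X̂∩J) − μ(X̂)μ(J)] + μ(E_y)μ(D_x)[μ(Ŷ∩J) − μ(Ŷ)μ(J)] ≤ μ(D_x)μ(D_y)[μ(A∩J) − μ(A)μ(J)]`,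
i.e. `Cov(A,J) ≥ τ_x·Cov(X̂,J) + τ_y·Cov(Ŷ,J)`. [this work] -/
theorem near_harris_rows (w : Sym2 V → unitInterval) (s x y a : V) (hxs : x ≠ s) (hys : y ≠ s) (hxy : x ≠ y)
    (hDx : 0 < (prodBernoulli w).real ((openConn x s)ᶜ ∩ (openConn x y)ᶜ : Set (BondConfig V)))
    (hDy : 0 < (prodBernoulli w).real ((openConn y s)ᶜ ∩ (openConn y x)ᶜ : Set (BondConfig V)))
    (hD0 : 0 < (prodBernoulli w).real ((openConn x y)ᶜ ∩ (openConn x s)ᶜ ∩ (openConn y s)ᶜ : Set (BondConfig V)))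
    (J : Set (BondConfig V))
    (hJ : J = openConn s x ∨ J = openConn s y ∨ J = openConn s x ∪ openConn s y ∨ J = openConn s x ∩ openConn s y) :
    (prodBernoulli w).real ((openConn x s)ᶜ ∩ (openConn x y)ᶜ ∩ openConn x a : Set (BondConfig V)) *
        (prodBernoulli w).real ((openConn y s)ᶜ ∩ (openConn y x)ᶜ : Set (BondConfig V)) *
        ((prodBernoulli w).real (openConn s x ∩ J : Set (BondConfig V)) -
          (prodBernoulli w).real (openConn s x : Set (BondConfig V)) * (prodBernoulli w).real J) +
      (prodBernoulli w).real ((openConn y s)ᶜ ∩ (openConn y x)ᶜ ∩ openConn y a : Set (BondConfig V)) *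
        (prodBernoulli w).real ((openConn x s)ᶜ ∩ (openConn x y)ᶜ : Set (BondConfig V)) *
        ((prodBernoulli w).real (openConn s y ∩ J : Set (BondConfig V)) -
          (prodBernoulli w).real (openConn s y : Set (BondConfig V)) * (prodBernoulli w).real J) ≤
    (prodBernoulli w).real ((openConn x s)ᶜ ∩ (openConn x y)ᶜ : Set (BondConfig V)) *
      (prodBernoulli w).real ((openConn y s)ᶜ ∩ (openConn y x)ᶜ : Set (BondConfig V)) *
      ((prodBernoulli w).real (openConn s a ∩ J : Set (BondConfig V)) -
        (prodBernoulli w).real (openConn s a : Set (BondConfig V)) * (prodBernoulli w).real J) := by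
  -- the two loner-attachment inequalities (θ ≤ τ at x and at y)
  have hx := near_theta_le_tau w s x y a hxs hxy
  have hy := near_theta_le_tau w s y x a hys (Ne.symm hxy)
  rcases hJ with rfl | rfl | rfl | rfl
  · -- J = X̂
    refine near_harris_row w s x y a hxs hys hxy _ (isUpperSet_openConn s x) (subset_union_left) hDx hDy hD0 ?_ ?_
    · rw [Ex_inter_X, X_inter_Dx]; simp
    · rw [show ((openConn y s)ᶜ ∩ (openConn y x)ᶜ ∩ openConn y a ∩ openConn s x : Set (BondConfig V))
          = (openConn y s)ᶜ ∩ (openConn y x)ᶜ ∩ (openConn y a ∩ openConn s x) from Ex_inter_Y s y x a,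
        show (openConn s x ∩ ((openConn y s)ᶜ ∩ (openConn y x)ᶜ) : Set (BondConfig V))
          = (openConn y s)ᶜ ∩ (openConn y x)ᶜ ∩ openConn s x from Y_inter_Dx s y x]
      exact hy
  · -- J = Ŷ
    refine near_harris_row w s x y a hxs hys hxy _ (isUpperSet_openConn s y) (subset_union_right) hDx hDy hD0 ?_ ?_
    · rw [Ex_inter_Y s x y a, Y_inter_Dx s x y]; exact hx
    · rw [Ex_inter_X, X_inter_Dx]; simp
  · -- J = Û
    refine near_harris_row w s x y a hxs hys hxy _ ((isUpperSet_openConn s x).union (isUpperSet_openConn s y))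
      (subset_refl _) hDx hDy hD0 ?_ ?_
    · rw [Ex_inter_U s x y a, U_inter_Dx s x y]; exact hx
    · rw [union_comm, Ex_inter_U s y x a, U_inter_Dx s y x]; exact hy
  · -- J = Ŵ
    refine near_harris_row w s x y a hxs hys hxy _ ((isUpperSet_openConn s x).inter (isUpperSet_openConn s y))
      (fun ω hω => Or.inl hω.1) hDx hDy hD0 ?_ ?_
    · rw [Ex_inter_W, W_inter_Dx]; simp
    · rw [inter_comm (openConn s x), Ex_inter_W, W_inter_Dx]; simp

end IncStarTwoCut

end Summit.CriticalPhenomena.PercolationContinuityZ3.Theorems
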